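import Mathlib

/-!
# `Balaban1983to89.B14DomainGeom` — [Balaban1988Convergent] pp. 254–259, 264–265, 269: the cube-layer GEOMETRY of the
domains `Ω_{k+1}, Λ_k, Λ_k^0` KERNEL-CHECKED — (3.5) forces `Ω_{k+1} ⊆ Λ_k^0` (indeed eight `LMR_{k+1}`-layers inside
`Λ_k`), hence the support of `φ_k − φ_Ω` (the seam of (2.45), cell GAPS.md G-adv6-1 / C-adv6-6) misses `Ω_{k+1}`

CITATION HEADER (lean-in-tree rule 2026-08-18).  Sources: T. Bałaban, *Convergent renormalization expansions for lattice
gauge theories*, Commun. Math. Phys. **119**, 243–285 (1988), doi:10.1007/bf01217741 (cell paper B14 = [III]; held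
`paper:balaban1988-cmp119-convergent-renormalization`; journal page = PDF page + 242; quotations read on the renders
`b2b-balaban-ref1/pages/1988-cmp119-convergent-renormalization/…-p012/p013/p014/p017/p022/p023/p027-x2.png`), and for
the meaning of the enlargement `X̃ⁿ`: T. Bałaban, *Renormalization group approach to lattice gauge field theories. I*,
Commun. Math. Phys. **109**, 249–301 (1987) [Balaban1987RG1] (= [I], cell paper B12) p. 257 [PDF 9] (render
`…1987-cmp109-rg-I-small-field-p009-x2.png`).  B14 is a manuscript UNDER ADJUDICATION by the audit cell `pub-balaban`:
nothing it asserts about fields, actions or expansions is used or reproduced here.  This module types ONLY the printed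
DEFINITIONS of the domains as set algebra on a cube-partitioned lattice and kernel-checks their set-theoretic
consequences; every `theorem` is finite integer / set bookkeeping, proved without `sorry` and without new axioms.
NEW sibling module of unit `b2b-balaban-pv02` (gen 2, journal claim P14-adv6a); it imports only `Mathlib` and modifies
nothing (companions: `…B14` (r2/pv04), `…B14Thm2` (pv01), `…B14Sect3` (pv02), `…B14RelBoundary` (b01)).

WHAT IS PRINTED (verbatim).
* [I] p. 257: *"We decompose the space T into the lattice of closed cubes of a size M … We denote this family of cubes
  by π_j, and the cubes by □, □′, etc. For a cube □ ∈ π_j and n = 1, 2, … we define □̃ⁿ as a cube of the size (1+2n)M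
  and with a center at the center of □. … The meaning of the symbol X̃ⁿ should be obvious."*  (So `X̃ⁿ` = `X` enlarged
  by `n` layers of cubes in the sup-metric sense, corners included: `enl` below.)
* B14 p. 254 (2.1): *"Ω₁ ⊃ Λ₁ ⊃ Ω₂ ⊃ Λ₂ ⊃ .... ⊃ Ω_j ⊃ Λ_j ⊃ .... ⊃ Ω_k ⊃ Λ_k"*; p. 255 (2.2)–(2.3): *"Γ_j =
  Ω_j^{(j)}∖Ω_{j+1}^{(j)} … Z_j = Λ_j^c"*; p. 256: *"The domains Ω_j, Λ_j, which are determined by he [sic] j-th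
  renormalization transformation, but not by the 𝐑-operation, are unions of MR_j-cubes in the lattice T_{L^{-j}}. They
  satisfy also other conditions, e.g., the distance between their boundaries is at least equal to 2MR_j, which will be
  determined inductively by the operations in the k+1-st step."*; p. 256 (2.9): *"R_n ≦ LR_m, R_m ≦ L(1+g_n²β′(n−m))^{β₀}
  R_n ≦ (L+1)(n−m)^{β₀}R_n"* (n > m); p. 259: *"Let us denote by Λ_j^0 the set which is obtained by removing one layer
  of the MR_j-cubes from Λ_j^{(j)} ⊂ T_1^{(j)}"*, *"φ_j ∈ C₀^∞(Λ_j), φ_j = 1 on Λ_j^{∼−1}"*.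
* B14 p. 264 [PDF 22]: *"The term has a large field region Z_k = Λ_k^c, and we denote by Z_k′ the union of all
  LMR_{k+1}-cubes intersecting the region Z_k, and belonging to the partition of the lattice T_η. This partition, or
  the corresponding partition of the lattice T_{L^{-1}η} into MR_{k+1}-cubes, is compatible with all the previous
  partitions. We surround Z_k′ by four layers of the LMR_{k+1}-cubes, i.e., we take the domain Z_k′^{∼4}"*; p. 265
  [PDF 23]: *"We take the set P′_{k+1} – the union of all LMR_{k+1}-cubes intersecting P_{k+1} – and we surround the
  union P′_{k+1}∪Z_k′^{∼4} by a layer of LMR_{k+1}-cubes. … Denote by P^1_{k+1} the subset of T^{(k+1)} such that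
  B^{k+1}(P^1_{k+1}) = (P′^∼_{k+1})^c ∩ (Z_k′^{∼5})^c. … We denote again by Q′_{k+1} the union of LMR_{k+1}-cubes
  intersecting Q_{k+1}, and we surround the domain Q′_{k+1}∪((B^{k+1}(P^1_{k+1}))^c)^∼ by two layers of such cubes.
  Denote Ω_{k+1} = (Q′^{∼2}_{k+1} ∪ (B^{k+1}(P^1_{k+1})^c)^{∼3})^c, (3.5) hence (Ω^{∼2}_{k+1})^c = Q′_{k+1} ∪
  (B^{k+1}(P^1_{k+1})^c)^∼."*; p. 269 (3.20): *"Λ_{k+1} = ((Ω^c_{k+1})^{∼2} ∪ R′^∼_{k+1})^c = Ω^{∼−2}_{k+1} ∩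
  (R′^∼_{k+1})^c"*.
* B14 p. 283 (3.65): *"h_z is defined as in (3.40), but on the lattice T_{L^{-j}}, and with h(t) = max{1 − |t|, 0}. For
  z ∈ Λ_j^0 we have h_zφ_j = h_z"*; p. 263 (2.45): *"Taking Ω = Bʲ(Λ_j^0), φ = φ_j in (2.43)"*.

THE CELL ITEM.  What pp. 280–283 prove of Theorem 2 (2.43) is the bound for the tent sum `φ_Ω = Σ_{z∈Λ_j^0∩Ω} h_z`, not
for a general `φ` (cell GAPS.md G-adv6-1, C-ref2-1); the consumed instance (2.45) therefore carries the extra term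
`β_j A(φ_j − φ_Ω, U_k)`, supported in the unit neighbourhood of the removed layer `Λ_j∖Λ_j^0`, and it is absorbed into
`E₁Σ_n(L^jL^{-n})^β|Γ_n∩Ω|` iff that support lies in `Ω_j∖Ω_{j+1}` (adversarial reader adv6, HANDOFF OPEN (a); adv6 gen 2
row C-adv6-6 (ii) derived it from the p. 256 sentence read as a statement about `∂Λ_j` and `∂Ω_{j+1}`).  THIS MODULE
shows the inclusion is FORCED by the printed construction (3.5) of the (k+1)-st step, independently of how the p. 256
sentence is read: `Ω_{k+1} ⊆ (Z_k′^{∼8})^c` (`omega35_subset_compl_enl`), every point of `Ω_{k+1}` is therefore more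
than `8·LMR_{k+1}` (sup-distance, k-th step units) from `Z_k = Λ_k^c` (`not_within_of_idx_sep`), while every point of the
removed layer `Λ_k∖Λ_k^0` is within `MR_k` of `Z_k` (`exists_outside_within_of_not_mem_innerN`); with (2.9)
`R_k ≦ (L+1)R_{k+1}` one has `MR_k + 1 ≦ 2LMR_{k+1} ≦ 8LMR_{k+1}` (`num_29`), so `Ω_{k+1} ⊆ Λ_k^0` (`omega35_subset_lambda0`)
and the unit neighbourhood of `Λ_k∖Λ_k^0` does not meet `Ω_{k+1}` (`disjoint_seam_omega35`), i.e. lies in `Ω_k∖Ω_{k+1}`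
where it meets `Λ_k ⊆ Ω_k` (`seam_inter_subset_sdiff`).  (3.20) gives the p. 256 sentence itself for the pair
`(Ω_{k+1}, Λ_{k+1})`: two `LMR_{k+1}`-layers = `2MR_{k+1}` in (k+1)-st step units (`lambda320_far_from_compl`).  The
printed "hence (Ω̃²_{k+1})^c = Q′ ∪ (B^c)^∼" holds as "⊇" only (`enl_compl_enl_subset_compl`; cell DIVERGENCE.md
D-pv02.12 — the text uses only this direction).

MODELLING (cell DIVERGENCE.md D-pv02.12).  Points are `Fin d → ℤ` (the universal cover of the torus `T_η` in units of
the η-lattice; every statement here is local — a bounded sup-distance — so it transfers to a torus of side larger than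
sixteen `LMR_{k+1}`-cubes); the partition into cubes of side `s` is `{y | ∀ i, s·a_i ≤ y_i < s·a_i + s}` (`cubeIdx` =
coordinatewise floor division); `X̃ⁿ = enl s n X` = the points whose cube is within `n` cubes, in every direction, of a
cube meeting `X` ([I] p. 257); "removing `n` layers of cubes from `Λ`" = `innerN s n Λ = ((Λ^c)^{∼n})^c`
(`innerN_eq_compl_enl_compl`).  Side lengths in η-lattice points: `MR_k·ν` for the `MR_k`-cubes and `LMR_{k+1}·ν` for
the `LMR_{k+1}`-cubes of the k-th step (`ν = η^{-1}` points per unit length), tents of sup-radius `ν` (one unit).  No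
compatibility of the two partitions is needed by the argument.  Residual NOT adjudicated here (cell GAPS.md C-B14s-05):
p. 255 *"we admit the possibility that Λ_j = Ω_j for some indices j. Such a situation may arise as a result of an
𝐑-operation"* — an 𝐑-operation ([Balaban1989LargeFieldI/II]) replacing `Λ_j` by a superset only enlarges `Λ_j^0`
(`innerN_mono`), so the inclusion survives it; whether 𝐑 does anything else to the sequences (2.1) is B15/B16's business.

CUBE CARRIER OF `Λ_j^0` (v2; cell GAPS.md G-adv6-13, C-adv6-7).  p. 259 removes *"one layer of the MR_j-cubes from
Λ_j^{(j)}"*, while p. 256 asserts the MR_j-cube structure only for the domains *"determined by he [sic] j-th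
renormalization transformation, but not by the 𝐑-operation"*; for 𝐑-produced domains (p. 255: *"we admit the
possibility that Λ_j = Ω_j for some indices j. Such a situation may arise as a result of an 𝐑-operation"*)
[Balaban1989LargeFieldI] p. 179 [PDF 5] (render `…1989-cmp122-large-field-I-p005-x2.png`) prints *"and complete these
two sets to a sequence Z″_k, Z″_{k−1}, …, Z″_{k−N₀+2}, Z″_{k−N₀+1} in such a way that the complements of these sets
form an admissible sequence of domains based on partitions into M-cubes in the corresponding scales. Thus Z″_k,
Z″_k∖Z″_{k−1} are unions of M-cubes of the lattice T_η, and Z″^c_k, Z″_{k−1} are separated by one layer of M-cubes.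
Similarly, Z″_{k−1}, Z″_{k−1}∖Z″_{k−2} are unions of L^{−1}M-cubes of this lattice, and Z″^c_{k−1}, Z″_{k−2} are
separated by one layer of L^{−1}M-cubes, and so on."* — M-cubes, not MR_j-cubes.  The cell therefore reads `Λ_j^0 :=
Λ_j^{(j)}` minus one layer of the cubes of ITS OWN partition (side `MR_j` for RT-produced, `M` for 𝐑-produced domains:
G-adv6-13's one-line repair, no change of mathematics).  In this module the side of `Λ`'s partition is the free
parameter `s` of `IsUnionOfCubes s Λ` / `innerN s 1 Λ` / `seam s 1 w Λ` — §§0–C are stated for arbitrary sides `s`, `s'`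
— and §D's specialisations to `s = MR_k·ν` cover the M-cube carrier through the instance `R_k := 1`
(`omega35_subset_lambda0_Mcubes`, `disjoint_seam_omega35_Mcubes`: side `M·ν`, no use of (2.9) — the margin
`8·LMR_{k+1}ν` of (3.5) exceeds `Mν + ν` outright).  This settles case (α) of C-adv6-7 (j = k: the pair `(Λ_k, Ω_{k+1})`
with `Ω_{k+1}` built by (3.5)) for either carrier; the pairs inside an 𝐑-component on the completed scales (C-adv6-7
(β)–(δ), from [Balaban1989LargeFieldI] (1.10)–(1.12)) are not (3.5)-pairs and are not typed here.
Value = typed skeleton of the printed definitions + a located-and-closed cell item, NOT summit progress.  Revision v2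
(gen 3): the CUBE CARRIER paragraph, the docstrings of `IsUnionOfCubes` / `seam` / `omega35_subset_lambda0`, and the two
`…_Mcubes` corollaries (G-adv6-13); no existing declaration changed.  Revision v3 (gen 4, cell GAPS.md G-adv6-20 /
G-adv6-21 (iii)): §E only — seam-membership facts for the sibling module's sign-free seam estimate (p. 283's *"h_zφ_j =
h_z"* is a printed sentence whose derivation from (2.24) + p. 259 depends on the unprinted cube family of `∼` in (2.24),
see §E), the room lemma for adv6's repair (a), and `□̃² ⊆ Λ_{n−1}` for `z ∈ Ω_n` from (3.5) (renders p017, p021, p037,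
p039, p041 re-read); no existing declaration changed.  Revision v3.1 (gen 4, cell GAPS.md G-pv13g3-2, cross-reader
`b2b-balaban-pv13` gen 3): DOCSTRING-ONLY precision of §E's reading clauses — v3's *"`Λ_j^{∼−1} = Λ_j^0` EXACTLY"* holds
under the `MR_j`-cube reading of `∼` in (2.24) (cell row G-adv6-20's), not under [Balaban1987RG1] p. 257's `M`-cube
reading, under which p. 283's sentence follows from (2.24) for `g_j` small ((2.5) p. 255); renders p013, p014 and
1987-cmp109 p009 re-read; no declaration touched.  Revision v4 (gen 24, cell GAPS.md C-adv5-92 (3) / C-adv5-93, journal claim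
PV02-G24-B14DOMAINGEOM-V4): §F only — the two-partition corner-cube containment `□^{∼n} ⊆ □′^{∼m} ⟺ n·s ≤ m·s′` for nested
partition cubes and its reading-invariant B14 instances (`(4,2) ⟺ 2R_k ≤ LR_{k+1}`, `(4,1) ⟺ 4R_k ≤ LR_{k+1}`); renders p004,
p015, p023, p024 read; no existing declaration changed.
-/

namespace Literature.MathematicalPhysics.QuantumFieldTheory.Balaban1983to89.B14DomainGeom

variable {d : ℕ}

/-! ## 0. Cubes, unions of cubes, enlargements `X̃ⁿ` and shrinkings `X^{∼-n}` -/

/-- Points of the lattice, modelled on `ℤ^d` (universal cover of the torus `T_η`, η-lattice units). [folklore] -/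
abbrev Pt (d : ℕ) := Fin d → ℤ

/-- `Within r x y`: the sup-distance of `x` and `y` is at most `r` (coordinatewise `|x i - y i| ≤ r`). [folklore] -/
def Within (r : ℤ) (x y : Pt d) : Prop := ∀ i, |x i - y i| ≤ r

/-- [folklore] -/
theorem Within.refl {r : ℤ} (hr : 0 ≤ r) (x : Pt d) : Within r x x := fun i => by simpa using hr

/-- [folklore] -/
theorem Within.mono {r r' : ℤ} (h : r ≤ r') {x y : Pt d} (hw : Within r x y) : Within r' x y :=
  fun i => (hw i).trans h

/-- Triangle inequality for the sup-distance. [folklore] -/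
theorem Within.triangle {r r' : ℤ} {x y z : Pt d} (h₁ : Within r x y) (h₂ : Within r' y z) :
    Within (r + r') x z := fun i =>
  calc |x i - z i| ≤ |x i - y i| + |y i - z i| := abs_sub_le _ _ _
    _ ≤ r + r' := add_le_add (h₁ i) (h₂ i)

/-- The index of the side-`s` cube containing `x`, for the partition of `ℤ^d` into the cubes
`{y | ∀ i, s·a i ≤ y i < s·a i + s}`, `a ∈ ℤ^d` (*"the partition of the lattice T_η into cubes …"*, B14 pp. 264–265):
coordinatewise floor division. [cite: Balaban1988Convergent, p.264 (partition of T_η into LMR_{k+1}-cubes), p.256] -/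
def cubeIdx (s : ℕ) (x : Pt d) : Pt d := fun i => x i / (s : ℤ)

/-- The cube of `x` starts at or below `x`. [folklore] -/
theorem cubeIdx_le (s : ℕ) (hs : 0 < s) (x : Pt d) (i : Fin d) : (s : ℤ) * cubeIdx s x i ≤ x i := by
  have h := Int.emod_add_mul_ediv (x i) (s : ℤ)
  have h0 : 0 ≤ x i % (s : ℤ) := Int.emod_nonneg _ (by exact_mod_cast hs.ne')
  unfold cubeIdx
  linarith

/-- The cube of `x` ends above `x`. [folklore] -/
theorem lt_cubeIdx (s : ℕ) (hs : 0 < s) (x : Pt d) (i : Fin d) : x i < (s : ℤ) * cubeIdx s x i + s := by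
  have h := Int.emod_add_mul_ediv (x i) (s : ℤ)
  have h1 : x i % (s : ℤ) < (s : ℤ) := Int.emod_lt_of_pos _ (by exact_mod_cast hs)
  unfold cubeIdx
  linarith

/-- A point whose coordinates lie in the cube of index `b` has cube index `b`. [folklore] -/
theorem cubeIdx_eq_of_mem (s : ℕ) (hs : 0 < s) (y b : Pt d)
    (h : ∀ i, (s : ℤ) * b i ≤ y i ∧ y i < (s : ℤ) * b i + s) : cubeIdx s y = b := by
  funext i
  obtain ⟨h1, h2⟩ := h i
  exact ((Int.ediv_emod_unique (a := y i) (b := (s : ℤ)) (r := y i - (s : ℤ) * b i) (q := b i)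
    (by exact_mod_cast hs)).mpr ⟨by ring, by linarith, by linarith⟩).1

/-- The corner `s·c` of the cube of index `c` has cube index `c`. [folklore] -/
theorem cubeIdx_corner (s : ℕ) (hs : 0 < s) (c : Pt d) : cubeIdx s (fun i => (s : ℤ) * c i) = c :=
  cubeIdx_eq_of_mem s hs _ c fun i => ⟨le_rfl, by linarith [show (0 : ℤ) < (s : ℤ) from mod_cast hs]⟩

/-- `Λ` is a union of cubes of the side-`s` partition (p. 256: *"unions of MR_j-cubes"*, printed for the domains not
produced by the 𝐑-operation; for 𝐑-produced ones the carrier is the partition into M-cubes, [Balaban1989LargeFieldI]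
p. 179 — the side `s` is a parameter here, see the module docstring, CUBE CARRIER). [cite: Balaban1988Convergent, p.256;
Balaban1989LargeFieldI, p.179] -/
def IsUnionOfCubes (s : ℕ) (Λ : Set (Pt d)) : Prop :=
  ∀ x y, cubeIdx s x = cubeIdx s y → (x ∈ Λ ↔ y ∈ Λ)

/-- The complement of a union of cubes is a union of cubes (`Z_k = Λ_k^c`). [folklore] -/
theorem IsUnionOfCubes.compl {s : ℕ} {Λ : Set (Pt d)} (h : IsUnionOfCubes s Λ) : IsUnionOfCubes s Λᶜ :=
  fun x y hxy => by simp only [Set.mem_compl_iff, h x y hxy]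

/-- `IdxNear s n x y`: the side-`s` cubes of `x` and `y` are at most `n` cubes apart in every direction
(`n = 0`: the same cube; `n = 1`: equal or touching, corners included). [folklore] -/
def IdxNear (s n : ℕ) (x y : Pt d) : Prop := ∀ i, |cubeIdx s x i - cubeIdx s y i| ≤ n

/-- [folklore] -/
theorem IdxNear.refl (s n : ℕ) (x : Pt d) : IdxNear s n x x := fun i => by simp

/-- [folklore] -/
theorem IdxNear.symm {s n : ℕ} {x y : Pt d} (h : IdxNear s n x y) : IdxNear s n y x :=
  fun i => by rw [abs_sub_comm]; exact h i

/-- Triangle inequality for cube-index distances. [folklore] -/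
theorem IdxNear.triangle {s a b : ℕ} {x y z : Pt d} (h₁ : IdxNear s a x y) (h₂ : IdxNear s b y z) :
    IdxNear s (a + b) x z := fun i =>
  calc |cubeIdx s x i - cubeIdx s z i| ≤ |cubeIdx s x i - cubeIdx s y i| + |cubeIdx s y i - cubeIdx s z i| :=
        abs_sub_le _ _ _
    _ ≤ (a : ℤ) + b := add_le_add (h₁ i) (h₂ i)
    _ = ((a + b : ℕ) : ℤ) := by push_cast; ring

/-- `enl s n X = X̃ⁿ` for the side-`s` cubes ([I] p. 257: *"□̃ⁿ … a cube of the size (1+2n)M and with a center at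
the center of □ … The meaning of the symbol X̃ⁿ should be obvious"*): the points whose cube is within `n` cubes, in
every direction, of a cube meeting `X`.  `enl s 0 X` = the union of the cubes meeting `X` (p. 264: *"Z_k′ the union of
all LMR_{k+1}-cubes intersecting the region Z_k"*), and `enl s n X = (enl s 0 X)^{∼n}` (`enl_enl`). [cite:
Balaban1987RG1, p.257 (□̃ⁿ, X̃ⁿ); Balaban1988Convergent, p.264 (Z_k′, Z_k′^{∼4})] -/
def enl (s n : ℕ) (X : Set (Pt d)) : Set (Pt d) := {x | ∃ y, y ∈ X ∧ IdxNear s n x y}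

/-- `innerN s n Λ = Λ^{∼-n}`: `Λ` with `n` layers of side-`s` cubes removed — the points of `Λ` whose cube has every
cube within `n` (each direction) inside `Λ`; `innerN s 1 Λ` with `s = MR_j` is p. 259's `Λ_j^0` (*"removing one layer of
the MR_j-cubes from Λ_j"*), and `innerN s n Ω = ((Ω^c)^{∼n})^c` (`innerN_eq_compl_enl_compl`, cf. (3.20)). [cite:
Balaban1988Convergent, p.259 (Λ_j^0), (3.20) p.269 (Ω^{∼−2})] -/
def innerN (s n : ℕ) (Λ : Set (Pt d)) : Set (Pt d) := {x | x ∈ Λ ∧ ∀ y, IdxNear s n x y → y ∈ Λ}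

/-- `X ⊆ X̃ⁿ`. [folklore] -/
theorem subset_enl (s n : ℕ) (X : Set (Pt d)) : X ⊆ enl s n X := fun x hx => ⟨x, hx, IdxNear.refl s n x⟩

/-- `X̃ⁿ` is monotone in `X`. [folklore] -/
theorem enl_mono (s n : ℕ) {X Y : Set (Pt d)} (h : X ⊆ Y) : enl s n X ⊆ enl s n Y := by
  rintro x ⟨y, hy, hn⟩
  exact ⟨y, h hy, hn⟩

/-- `X̃ⁿ` is monotone in `n`. [folklore] -/
theorem enl_mono_layers (s : ℕ) {n n' : ℕ} (h : n ≤ n') (X : Set (Pt d)) : enl s n X ⊆ enl s n' X := by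
  rintro x ⟨y, hy, hn⟩
  exact ⟨y, hy, fun i => (hn i).trans (by exact_mod_cast h)⟩

/-- `~` distributes over unions (`P′^∼ ∪ Z′^{∼5} = (P′ ∪ Z′^{∼4})^∼`, p. 265). [folklore] -/
theorem enl_union (s n : ℕ) (X Y : Set (Pt d)) : enl s n (X ∪ Y) = enl s n X ∪ enl s n Y := by
  ext x
  simp only [enl, Set.mem_setOf_eq, Set.mem_union]
  constructor
  · rintro ⟨y, hy | hy, hn⟩
    · exact Or.inl ⟨y, hy, hn⟩
    · exact Or.inr ⟨y, hy, hn⟩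
  · rintro (⟨y, hy, hn⟩ | ⟨y, hy, hn⟩)
    · exact ⟨y, Or.inl hy, hn⟩
    · exact ⟨y, Or.inr hy, hn⟩

/-- Coordinatewise clamp of an index `a` into the interval `[b - r, b + r]`. [folklore] -/
def clampIdx (r : ℤ) (a b : ℤ) : ℤ := max (b - r) (min a (b + r))

/-- The clamped index is within `r` of `b`. [folklore] -/
theorem clampIdx_near (r : ℤ) (hr : 0 ≤ r) (a b : ℤ) : |clampIdx r a b - b| ≤ r := by
  unfold clampIdx
  rw [abs_le]
  rcases le_total (b - r) (min a (b + r)) with h | h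
  · rw [max_eq_right h]
    exact ⟨by linarith, by have := min_le_right a (b + r); linarith⟩
  · rw [max_eq_left h]
    exact ⟨by linarith, by linarith⟩

/-- Clamping into the `r`-ball moves an index at distance `≤ r + t` by at most `t`. [folklore] -/
theorem clampIdx_moves (r t : ℤ) (hr : 0 ≤ r) (ht : 0 ≤ t) (a b : ℤ) (hab : |a - b| ≤ r + t) :
    |a - clampIdx r a b| ≤ t := by
  unfold clampIdx
  obtain ⟨h1, h2⟩ := abs_le.mp hab
  rw [abs_le]
  rcases le_total a (b + r) with h' | h'
  · rw [min_eq_left h']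
    rcases le_total (b - r) a with h | h
    · rw [max_eq_right h]; exact ⟨by linarith, by linarith⟩
    · rw [max_eq_left h]; exact ⟨by linarith, by linarith⟩
  · rw [min_eq_right h']
    rw [max_eq_right (by linarith)]
    exact ⟨by linarith, by linarith⟩

/-- **Layers compose additively**: `(X̃ᵃ)^{∼b} = X̃^{a+b}` — surrounding `Z_k′^{∼4}` *"by a layer"* gives `Z_k′^{∼5}`,
etc. (pp. 264–265).  The inclusion `⊇` needs `0 < s` (an intermediate cube must contain a lattice point). [folklore] -/
theorem enl_enl (s a b : ℕ) (hs : 0 < s) (X : Set (Pt d)) : enl s b (enl s a X) = enl s (a + b) X := by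
  ext x
  constructor
  · rintro ⟨y, ⟨z, hz, hyz⟩, hxy⟩
    refine ⟨z, hz, ?_⟩
    have := IdxNear.triangle hxy hyz
    simpa [Nat.add_comm] using this
  · rintro ⟨z, hz, hxz⟩
    -- clamp the index of `x` into the `a`-ball around the index of `z`; take the corner of that cube
    let c : Pt d := fun i => clampIdx (a : ℤ) (cubeIdx s x i) (cubeIdx s z i)
    have hyc : cubeIdx s (fun i => (s : ℤ) * c i) = c := cubeIdx_corner s hs c
    refine ⟨fun i => (s : ℤ) * c i, ⟨z, hz, fun i => ?_⟩, fun i => ?_⟩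
    · rw [hyc]
      exact clampIdx_near (a : ℤ) (by positivity) _ _
    · rw [hyc]
      refine clampIdx_moves (a : ℤ) (b : ℤ) (by positivity) (by positivity) _ _ ?_
      have := hxz i
      push_cast at this
      exact this

/-- `Λ^{∼-n} ⊆ Λ`. [folklore] -/
theorem innerN_subset (s n : ℕ) (Λ : Set (Pt d)) : innerN s n Λ ⊆ Λ := fun _ hx => hx.1

/-- `Λ^{∼-n}` is monotone in `Λ` (an 𝐑-operation enlarging `Λ_j` only enlarges `Λ_j^0`). [folklore] -/
theorem innerN_mono (s n : ℕ) {Λ Λ' : Set (Pt d)} (h : Λ ⊆ Λ') : innerN s n Λ ⊆ innerN s n Λ' :=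
  fun _ hx => ⟨h hx.1, fun y hy => h (hx.2 y hy)⟩

/-- `Λ^{∼-n} = ((Λ^c)^{∼n})^c` — the two printed forms of (3.20). [folklore] -/
theorem innerN_eq_compl_enl_compl (s n : ℕ) (Λ : Set (Pt d)) : innerN s n Λ = (enl s n Λᶜ)ᶜ := by
  ext x
  simp only [innerN, enl, Set.mem_setOf_eq, Set.mem_compl_iff, not_exists, not_and]
  constructor
  · rintro ⟨-, h⟩ y hy hn
    exact hy (h y hn)
  · intro h
    refine ⟨?_, fun y hn => ?_⟩
    · by_contra hx
      exact h x hx (IdxNear.refl s n x)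
    · by_contra hy
      exact h y hy hn

/-- The printed *"hence (Ω̃²_{k+1})^c = Q′_{k+1} ∪ (B^{k+1}(P^1_{k+1})^c)^∼"* after (3.5): with `Ω = (W̃²)^c` one has
`Ω̃² ⊆ W^c` — this direction (the one used: no large-field functions on `Ω̃²`) holds for every `W`; the printed equality
does not in general (e.g. `W^c` a single cube: then `Ω = ∅`).  Cell DIVERGENCE.md D-pv02.12. [cite:
Balaban1988Convergent, p.265 (sentence after (3.5)), ⊇-direction only] -/
theorem enl_compl_enl_subset_compl (s n : ℕ) (W : Set (Pt d)) : enl s n (enl s n W)ᶜ ⊆ Wᶜ := by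
  rintro x ⟨y, hy, hxy⟩ hxW
  exact hy ⟨x, hxW, hxy.symm⟩

/-! ## A. The removed layers lie within sup-distance `n·s` of the complement -/

/-- If `x` is not in `Λ^{∼-n}` (side `s`; `Λ` a union of such cubes), some point outside `Λ` is within sup-distance
`n·s` of `x`.  (For `x ∈ Λ`: its cube is within `n` cubes of a cube outside `Λ`; clamp `x` into that cube.) [folklore] -/
theorem exists_outside_within_of_not_mem_innerN (s n : ℕ) (hs : 0 < s) {Λ : Set (Pt d)}
    (hΛ : IsUnionOfCubes s Λ) {x : Pt d} (hx0 : x ∉ innerN s n Λ) :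
    ∃ y, y ∉ Λ ∧ Within ((n : ℤ) * s) x y := by
  classical
  by_cases hx : x ∈ Λ
  swap
  · exact ⟨x, hx, Within.refl (by positivity) x⟩
  have : ¬ ∀ y, IdxNear s n x y → y ∈ Λ := fun h => hx0 ⟨hx, h⟩
  push Not at this
  obtain ⟨y₀, hnear, hy₀⟩ := this
  set b := cubeIdx s y₀ with hb
  -- clamp `x` coordinatewise into the cube of `y₀`
  let y : Pt d := fun i =>
    if x i < (s : ℤ) * b i then (s : ℤ) * b i
    else if (s : ℤ) * b i + s ≤ x i then (s : ℤ) * b i + s - 1 else x i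
  have hy_cube : ∀ i, (s : ℤ) * b i ≤ y i ∧ y i < (s : ℤ) * b i + s := by
    intro i
    have hs' : (0 : ℤ) < s := by exact_mod_cast hs
    simp only [y]
    split_ifs with h1 h2
    · constructor <;> linarith
    · constructor <;> linarith
    · constructor <;> linarith
  have hidx : cubeIdx s y = b := cubeIdx_eq_of_mem s hs y b hy_cube
  refine ⟨y, fun hyΛ => hy₀ ((hΛ y y₀ (by rw [hidx])).mp hyΛ), fun i => ?_⟩
  have hs' : (0 : ℤ) < s := by exact_mod_cast hs
  have hax := cubeIdx_le s hs x i
  have hxa := lt_cubeIdx s hs x i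
  have hn := hnear i
  have hab : (s : ℤ) * cubeIdx s x i - (s : ℤ) * b i ≤ (n : ℤ) * s := by
    have := (abs_le.mp hn).2
    nlinarith
  have hba : (s : ℤ) * b i - (s : ℤ) * cubeIdx s x i ≤ (n : ℤ) * s := by
    have := (abs_le.mp hn).1
    nlinarith
  generalize hA : (s : ℤ) * cubeIdx s x i = A at hax hxa hab hba
  generalize hB : (s : ℤ) * b i = B at hab hba
  have hyi : y i = if x i < B then B else if B + s ≤ x i then B + s - 1 else x i := by
    simp only [y, hB]
  rw [hyi]
  split_ifs with h1 h2
  · rw [abs_le]; constructor <;> linarith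
  · rw [abs_le]; constructor <;> nlinarith
  · rw [sub_self, abs_zero]; positivity

/-! ## B. Cubes far apart in index are far apart in sup-distance -/

/-- If the side-`s'` cubes of `x` and `y` are at least `m+1` apart in some direction, then `x` and `y` are NOT within
sup-distance `m·s'` (they are `≥ m·s' + 1` apart). [folklore] -/
theorem not_within_of_idx_sep (s' m : ℕ) (hs : 0 < s') {x y : Pt d}
    (hsep : ∃ i, (m : ℤ) + 1 ≤ |cubeIdx s' x i - cubeIdx s' y i|) : ¬ Within ((m : ℤ) * s') x y := by
  obtain ⟨i, hi⟩ := hsep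
  intro hw
  have hwi := abs_le.mp (hw i)
  have hs' : (0 : ℤ) < s' := by exact_mod_cast hs
  have hax := cubeIdx_le s' hs x i
  have hxa := lt_cubeIdx s' hs x i
  have hby := cubeIdx_le s' hs y i
  have hyb := lt_cubeIdx s' hs y i
  rcases le_abs.mp hi with h | h
  · have : (s' : ℤ) * cubeIdx s' y i + (m : ℤ) * s' + s' ≤ (s' : ℤ) * cubeIdx s' x i := by nlinarith
    linarith
  · have : (s' : ℤ) * cubeIdx s' x i + (m : ℤ) * s' + s' ≤ (s' : ℤ) * cubeIdx s' y i := by nlinarith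
    linarith

/-- Outside `X̃ᵐ` (side `s'`): index separation `≥ m+1`, in some direction, from every point of `X`. [folklore] -/
theorem idx_sep_of_not_mem_enl (s' m : ℕ) {X : Set (Pt d)} {x : Pt d} (hx : x ∉ enl s' m X)
    {y : Pt d} (hy : y ∈ X) : ∃ i, (m : ℤ) + 1 ≤ |cubeIdx s' x i - cubeIdx s' y i| := by
  by_contra h
  push Not at h
  exact hx ⟨y, hy, fun i => by have := h i; omega⟩

/-- Hence: a set disjoint from `Z̃ᵐ` keeps sup-distance `> m·s'` from `Z`. [folklore] -/
theorem not_within_of_subset_compl_enl (s' m : ℕ) (hs : 0 < s') {Z Ω : Set (Pt d)} (hΩ : Ω ⊆ (enl s' m Z)ᶜ)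
    {x : Pt d} (hx : x ∈ Ω) {y : Pt d} (hy : y ∈ Z) : ¬ Within ((m : ℤ) * s') x y :=
  not_within_of_idx_sep s' m hs (idx_sep_of_not_mem_enl s' m (hΩ hx) hy)

/-! ## C. The inclusion `Ω′ ⊆ Λ^{∼-n}` and the seam, abstractly -/

/-- **Inclusion.**  `Λ` a union of side-`s` cubes, `Ω′` disjoint from `(Λ^c)^{∼m}` (side `s'`), `n·s ≤ m·s'`:
then `Ω′ ⊆ Λ^{∼-n}` (side `s`). [folklore] -/
theorem subset_innerN_of_subset_compl_enl (s s' n m : ℕ) (hs : 0 < s) (hs' : 0 < s') {Λ Ω' : Set (Pt d)}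
    (hΛ : IsUnionOfCubes s Λ) (hΩ : Ω' ⊆ (enl s' m Λᶜ)ᶜ) (hnum : (n : ℤ) * s ≤ (m : ℤ) * s') :
    Ω' ⊆ innerN s n Λ := by
  intro x hx
  by_contra hx0
  obtain ⟨y, hyΛ, hw⟩ := exists_outside_within_of_not_mem_innerN s n hs hΛ hx0
  exact not_within_of_subset_compl_enl s' m hs' hΩ hx hyΛ (hw.mono hnum)

/-- The sup-`w`-neighbourhood of the complement of `Λ^{∼-n}`.  For `n = 1`, `s` = the side of `Λ_j`'s own partition
cubes (`MR_j·ν`; `M·ν` for an 𝐑-produced `Λ_j` — module docstring, CUBE CARRIER), `w = ν` (one unit) it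
contains the support of `φ_j − φ_Ω = Σ_{z∉Λ_j^0} h_zφ_j` (unit tents `h_z`, (3.65); `Ω = Bʲ(Λ_j^0)`, (2.45)). [cite:
Balaban1988Convergent, (3.65) p.283 (unit tents h_z, z ∈ T^{(j)}), (2.45) p.263 (Ω = Bʲ(Λ_j^0), φ = φ_j)] -/
def seam (s n : ℕ) (w : ℤ) (Λ : Set (Pt d)) : Set (Pt d) := {x | ∃ z, z ∉ innerN s n Λ ∧ Within w x z}

/-- The removed layers themselves lie in the seam. [folklore] -/
theorem sdiff_subset_seam (s n : ℕ) {w : ℤ} (hw : 0 ≤ w) (Λ : Set (Pt d)) : Λ \ innerN s n Λ ⊆ seam s n w Λ :=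
  fun x hx => ⟨x, hx.2, Within.refl hw x⟩

/-- **Seam.**  Under the same disjointness, if `n·s + w ≤ m·s'` the `w`-neighbourhood of `(Λ^{∼-n})^c` does not
meet `Ω′`. [folklore] -/
theorem disjoint_seam_of_subset_compl_enl (s s' n m : ℕ) (w : ℤ) (hs : 0 < s) (hs' : 0 < s')
    {Λ Ω' : Set (Pt d)} (hΛ : IsUnionOfCubes s Λ) (hΩ : Ω' ⊆ (enl s' m Λᶜ)ᶜ)
    (hnum : (n : ℤ) * s + w ≤ (m : ℤ) * s') : Disjoint (seam s n w Λ) Ω' := by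
  rw [Set.disjoint_left]
  rintro x ⟨z, hz0, hxz⟩ hxΩ
  obtain ⟨y, hyΛ, hzy⟩ := exists_outside_within_of_not_mem_innerN s n hs hΛ hz0
  refine not_within_of_subset_compl_enl s' m hs' hΩ hxΩ hyΛ ?_
  exact (hxz.triangle hzy).mono (by linarith)

/-! ## D. B14 (3.5): `Ω_{k+1}` misses eight `LMR_{k+1}`-layers around `Z_k = Λ_k^c`; (3.20) -/

/-- **(3.5) transcribed.**  With `Z' = enl s' 0 Z` (the `LMR_{k+1}`-cubes meeting `Z = Z_k`), `B = B^{k+1}(P^1_{k+1})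
= (P′^∼)^c ∩ (Z′^{∼5})^c` and `Ω_{k+1} = (Q′^{∼2} ∪ (B^c)^{∼3})^c` (any sets `P′^∼`, `Q′^{∼2}`), one has
`Ω_{k+1} ⊆ (Z̃⁸)^c`. [cite: Balaban1988Convergent, (3.5) p.265, p.264 (Z_k = Λ_k^c, Z_k′, Z_k′^{∼4}), p.265
(B^{k+1}(P^1_{k+1}) = (P′^∼)^c ∩ (Z_k′^{∼5})^c)] -/
theorem omega35_subset_compl_enl (s' : ℕ) (hs' : 0 < s') (Z Pt' Q2 B Ω : Set (Pt d))
    (hB : B = Pt'ᶜ ∩ (enl s' 5 (enl s' 0 Z))ᶜ) (hΩ : Ω = (Q2 ∪ enl s' 3 Bᶜ)ᶜ) :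
    Ω ⊆ (enl s' 8 Z)ᶜ := by
  intro x hx hx8
  have h5 : enl s' 5 (enl s' 0 Z) ⊆ Bᶜ := by
    intro y hy hyB
    rw [hB] at hyB
    exact hyB.2 hy
  have h8 : enl s' 8 Z ⊆ enl s' 3 Bᶜ := by
    calc enl s' 8 Z = enl s' 3 (enl s' 5 (enl s' 0 Z)) := by rw [enl_enl s' 0 5 hs', enl_enl s' 5 3 hs']
      _ ⊆ enl s' 3 Bᶜ := enl_mono s' 3 h5
  rw [hΩ] at hx
  exact hx (Or.inr (h8 hx8))

/-- `Ω_{k+1} ⊆ Λ_k`: (2.1)'s `Λ_k ⊃ Ω_{k+1}` is a consequence of (3.5) (`Z_k = Λ_k^c ⊆ Z̃⁸`). [cite: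
Balaban1988Convergent, (2.1) p.254, (3.5) p.265] -/
theorem omega35_subset_lambda {s' : ℕ} {Λ Ω : Set (Pt d)} (hΩ : Ω ⊆ (enl s' 8 Λᶜ)ᶜ) : Ω ⊆ Λ := by
  intro x hx
  by_contra hxΛ
  exact hΩ hx (subset_enl s' 8 Λᶜ hxΛ)

/-- **(2.9) ⇒ the numerical room.**  Sides in η-lattice points: `MR_k·ν` (the `MR_k`-cubes of `Λ_k`, k-th step units)
and `LMR_{k+1}·ν` (the `LMR_{k+1}`-cubes of (3.5)), tent radius `ν`; with `R_k ≦ (L+1)R_{k+1}` ((2.9), n − m = 1),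
`L ≥ 2`, `M, R_{k+1}, ν ≥ 1`:  `MR_kν + ν ≤ 2·LMR_{k+1}ν (≤ 8·LMR_{k+1}ν)`. [cite: Balaban1988Convergent, (2.9) p.256
(R_m ≦ (L+1)(n−m)^{β₀}R_n, n = k+1, m = k)] -/
theorem num_29 (L M Rk Rk1 ν : ℕ) (hL : 2 ≤ L) (hM : 1 ≤ M) (hR : 1 ≤ Rk1) (hν : 1 ≤ ν)
    (h29 : (Rk : ℤ) ≤ (L + 1) * Rk1) :
    ((M * Rk * ν : ℕ) : ℤ) + ν ≤ 2 * ((L * M * Rk1 * ν : ℕ) : ℤ) := by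
  push_cast
  have hM' : (1 : ℤ) ≤ M := by exact_mod_cast hM
  have hR' : (1 : ℤ) ≤ Rk1 := by exact_mod_cast hR
  have hν' : (1 : ℤ) ≤ ν := by exact_mod_cast hν
  have hL' : (1 : ℤ) ≤ (L : ℤ) - 1 := by linarith [show (2 : ℤ) ≤ (L : ℤ) from mod_cast hL]
  have h1 : (M : ℤ) * Rk * ν ≤ M * ((L + 1) * Rk1) * ν := by gcongr
  have h2 : (1 : ℤ) ≤ ((L : ℤ) - 1) * M * Rk1 :=
    one_le_mul_of_one_le_of_one_le (one_le_mul_of_one_le_of_one_le hL' hM') hR'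
  have h3 : (ν : ℤ) ≤ ((L : ℤ) - 1) * M * Rk1 * ν := le_mul_of_one_le_left (by linarith) h2
  nlinarith

/-- **`Ω_{k+1} ⊆ Λ_k^0`.**  `Λ = Λ_k` a union of cubes of side `s = MR_kν`, `Ω = Ω_{k+1}` of (3.5) built with cubes
of side `s' = LMR_{k+1}ν` from `Z = Λ^c`; (2.9): then `Ω_{k+1} ⊆ Λ_k^0 = innerN s 1 Λ` — the inclusion behind
(2.45)/(2.48) (cell GAPS.md G-adv6-1 (a), C-adv6-6 (ii), C-B14s-05); for an 𝐑-produced `Λ_k` (a union of M-cubes) see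
`omega35_subset_lambda0_Mcubes`. [cite: Balaban1988Convergent, (3.5) p.265, p.259 (Λ_j^0), p.256 ((2.9); Ω_j, Λ_j unions
of MR_j-cubes)] -/
theorem omega35_subset_lambda0 (L M Rk Rk1 ν : ℕ) (hL : 2 ≤ L) (hM : 1 ≤ M) (hRk : 1 ≤ Rk) (hR : 1 ≤ Rk1)
    (hν : 1 ≤ ν) (h29 : (Rk : ℤ) ≤ (L + 1) * Rk1) {Λ Pt' Q2 B Ω : Set (Pt d)}
    (hΛ : IsUnionOfCubes (M * Rk * ν) Λ)
    (hB : B = Pt'ᶜ ∩ (enl (L * M * Rk1 * ν) 5 (enl (L * M * Rk1 * ν) 0 Λᶜ))ᶜ)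
    (hΩ : Ω = (Q2 ∪ enl (L * M * Rk1 * ν) 3 Bᶜ)ᶜ) :
    Ω ⊆ innerN (M * Rk * ν) 1 Λ := by
  have hs : 0 < M * Rk * ν := Nat.mul_pos (Nat.mul_pos hM hRk) hν
  have hs' : 0 < L * M * Rk1 * ν := Nat.mul_pos (Nat.mul_pos (Nat.mul_pos (by omega) hM) hR) hν
  have h8 := omega35_subset_compl_enl (L * M * Rk1 * ν) hs' Λᶜ Pt' Q2 B Ω hB hΩ
  refine subset_innerN_of_subset_compl_enl _ _ 1 8 hs hs' hΛ h8 ?_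
  have := num_29 L M Rk Rk1 ν hL hM hR hν h29
  push_cast at this ⊢
  have hν0 : (0 : ℤ) ≤ ν := by positivity
  nlinarith

/-- **The seam misses `Ω_{k+1}`.**  Same data; the unit (`ν` η-points) sup-neighbourhood of `(Λ_k^0)^c` — which carries
`φ_k − φ_Ω`, `Ω = Bᵏ(Λ_k^0)` — is disjoint from `Ω_{k+1}`. [cite: Balaban1988Convergent, (3.5) p.265, (3.65) p.283,
(2.45) p.263, (2.9) p.256] -/
theorem disjoint_seam_omega35 (L M Rk Rk1 ν : ℕ) (hL : 2 ≤ L) (hM : 1 ≤ M) (hRk : 1 ≤ Rk) (hR : 1 ≤ Rk1)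
    (hν : 1 ≤ ν) (h29 : (Rk : ℤ) ≤ (L + 1) * Rk1) {Λ Pt' Q2 B Ω : Set (Pt d)}
    (hΛ : IsUnionOfCubes (M * Rk * ν) Λ)
    (hB : B = Pt'ᶜ ∩ (enl (L * M * Rk1 * ν) 5 (enl (L * M * Rk1 * ν) 0 Λᶜ))ᶜ)
    (hΩ : Ω = (Q2 ∪ enl (L * M * Rk1 * ν) 3 Bᶜ)ᶜ) :
    Disjoint (seam (M * Rk * ν) 1 (ν : ℤ) Λ) Ω := by
  have hs : 0 < M * Rk * ν := Nat.mul_pos (Nat.mul_pos hM hRk) hν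
  have hs' : 0 < L * M * Rk1 * ν := Nat.mul_pos (Nat.mul_pos (Nat.mul_pos (by omega) hM) hR) hν
  have h8 := omega35_subset_compl_enl (L * M * Rk1 * ν) hs' Λᶜ Pt' Q2 B Ω hB hΩ
  refine disjoint_seam_of_subset_compl_enl _ _ 1 8 (ν : ℤ) hs hs' hΛ h8 ?_
  have := num_29 L M Rk Rk1 ν hL hM hR hν h29
  push_cast at this ⊢
  have hν0 : (0 : ℤ) ≤ ν := by positivity
  nlinarith

/-- **M-cube carrier (cell GAPS.md G-adv6-13).**  For an 𝐑-produced `Λ_k` — a union of cubes of side `M·ν`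
([Balaban1989LargeFieldI] p. 179: *"unions of M-cubes of the lattice T_η"*), `Λ_k^0 = innerN (Mν) 1 Λ_k` (one layer of
ITS OWN cubes removed) — the inclusion `Ω_{k+1} ⊆ Λ_k^0` holds with NO use of (2.9): instance `R_k := 1` of
`omega35_subset_lambda0`. [cite: Balaban1988Convergent, (3.5) p.265, p.259 (Λ_j^0); Balaban1989LargeFieldI, p.179] -/
theorem omega35_subset_lambda0_Mcubes (L M Rk1 ν : ℕ) (hL : 2 ≤ L) (hM : 1 ≤ M) (hR : 1 ≤ Rk1) (hν : 1 ≤ ν)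
    {Λ Pt' Q2 B Ω : Set (Pt d)} (hΛ : IsUnionOfCubes (M * ν) Λ)
    (hB : B = Pt'ᶜ ∩ (enl (L * M * Rk1 * ν) 5 (enl (L * M * Rk1 * ν) 0 Λᶜ))ᶜ)
    (hΩ : Ω = (Q2 ∪ enl (L * M * Rk1 * ν) 3 Bᶜ)ᶜ) :
    Ω ⊆ innerN (M * ν) 1 Λ := by
  have hΛ' : IsUnionOfCubes (M * 1 * ν) Λ := by simpa using hΛ
  have h29 : ((1 : ℕ) : ℤ) ≤ (L + 1) * Rk1 := by
    have hR' : (1 : ℤ) ≤ Rk1 := by exact_mod_cast hR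
    have hL' : (2 : ℤ) ≤ L := by exact_mod_cast hL
    push_cast; nlinarith
  have h := omega35_subset_lambda0 L M 1 Rk1 ν hL hM le_rfl hR hν h29 hΛ' hB hΩ
  simpa using h

/-- **M-cube carrier, seam.**  Same data: the unit sup-neighbourhood of `(Λ_k^0)^c`, `Λ_k^0` = `Λ_k` minus one layer of
its own `M·ν`-cubes, is disjoint from `Ω_{k+1}` (instance `R_k := 1` of `disjoint_seam_omega35`; G-adv6-13: the seam is
thinner, width `M` instead of `MR_k`). [cite: Balaban1988Convergent, (3.5) p.265, (3.65) p.283; Balaban1989LargeFieldI,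
p.179] -/
theorem disjoint_seam_omega35_Mcubes (L M Rk1 ν : ℕ) (hL : 2 ≤ L) (hM : 1 ≤ M) (hR : 1 ≤ Rk1) (hν : 1 ≤ ν)
    {Λ Pt' Q2 B Ω : Set (Pt d)} (hΛ : IsUnionOfCubes (M * ν) Λ)
    (hB : B = Pt'ᶜ ∩ (enl (L * M * Rk1 * ν) 5 (enl (L * M * Rk1 * ν) 0 Λᶜ))ᶜ)
    (hΩ : Ω = (Q2 ∪ enl (L * M * Rk1 * ν) 3 Bᶜ)ᶜ) :
    Disjoint (seam (M * ν) 1 (ν : ℤ) Λ) Ω := by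
  have hΛ' : IsUnionOfCubes (M * 1 * ν) Λ := by simpa using hΛ
  have h29 : ((1 : ℕ) : ℤ) ≤ (L + 1) * Rk1 := by
    have hR' : (1 : ℤ) ≤ Rk1 := by exact_mod_cast hR
    have hL' : (2 : ℤ) ≤ L := by exact_mod_cast hL
    push_cast; nlinarith
  have h := disjoint_seam_omega35 L M 1 Rk1 ν hL hM le_rfl hR hν h29 hΛ' hB hΩ
  simpa using h

/-- Hence, with (2.1) `Λ_k ⊆ Ω_k`: the part of the seam inside `Λ_k` (where `φ_k` lives, `φ_k ∈ C₀^∞(Λ_k)`) lies in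
`Ω_k ∖ Ω_{k+1}`, the region counted by `|Γ_k ∩ Ω|` in (2.43). [folklore] -/
theorem seam_inter_subset_sdiff {S Λ Ωk Ωk1 : Set (Pt d)} (h21 : Λ ⊆ Ωk) (hdisj : Disjoint S Ωk1) :
    S ∩ Λ ⊆ Ωk \ Ωk1 := fun _ hx =>
  ⟨h21 hx.2, fun hx1 => (Set.disjoint_left.mp hdisj) hx.1 hx1⟩

/-- **(3.20) ⇒ p. 256 for the pair `(Ω_{k+1}, Λ_{k+1})`.**  `Λ_{k+1} = ((Ω^c_{k+1})^{∼2} ∪ R′^∼_{k+1})^c` (side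
`s' = LMR_{k+1}ν`): every point of `Λ_{k+1}` is more than `2s'` (sup-distance) from every point outside `Ω_{k+1}` —
*"the distance between their boundaries is at least equal to 2MR_j"* (`2LMR_{k+1}` k-th step units = `2MR_{k+1}` in the
units of step k+1). [cite: Balaban1988Convergent, (3.20) p.269, p.256 ("the distance between their boundaries is at
least equal to 2MR_j")] -/
theorem lambda320_far_from_compl (s' : ℕ) (hs' : 0 < s') {Ω R1 Λ1 : Set (Pt d)}
    (h320 : Λ1 = (enl s' 2 Ωᶜ ∪ R1)ᶜ) {x : Pt d} (hx : x ∈ Λ1) {y : Pt d} (hy : y ∉ Ω) :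
    ¬ Within (2 * (s' : ℤ)) x y := by
  have hx2 : x ∉ enl s' 2 Ωᶜ := by
    rw [h320] at hx
    exact fun h => hx (Or.inl h)
  have := not_within_of_idx_sep s' 2 hs' (idx_sep_of_not_mem_enl s' 2 hx2 hy)
  simpa using this

/-- (3.20) also gives `Λ_{k+1} ⊆ Ω_{k+1}^{∼-2} = innerN s' 2 Ω_{k+1}` (the second printed form). [cite:
Balaban1988Convergent, (3.20) p.269] -/
theorem lambda320_subset_innerN (s' : ℕ) {Ω R1 Λ1 : Set (Pt d)} (h320 : Λ1 = (enl s' 2 Ωᶜ ∪ R1)ᶜ) :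
    Λ1 ⊆ innerN s' 2 Ω := by
  intro x hx
  rw [innerN_eq_compl_enl_compl]
  rw [h320] at hx
  exact fun h => hx (Or.inl h)

/-! ## E. (v3) Seam membership for the sign-free seam estimate; `□̃² ⊆ Λ_{n−1}` (cell GAPS.md G-adv6-20, G-adv6-21 (iii))

Cell GAPS.md G-adv6-20 (adversarial reader adv6, gen 8) and, for the reading clauses, G-pv13g3-2 (cross-reader pv13
gen 3; v3.1).  p. 283 [PDF 41] prints *"For z ∈ Λ_j^0 we have h_zφ_j = h_z"*; whether this is a consequence of p. 259
[PDF 17] *"φ_j ∈ C₀^∞(Λ_j), φ_j = 1 on Λ_j^{∼−1}"* and *"Λ_j^0 the set which is obtained by removing one layer of the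
MR_j-cubes from Λ_j^{(j)}"* depends on the cube family of `∼` in (2.24), which p. 259 does not name (p. 263 [PDF 21]
*"the operation ∼ is in the corresponding scale"* fixes the lattice, not the cube size).  If `∼` removes one layer of
`MR_j`-cubes (the reading of cell row G-adv6-20; p. 256 [PDF 14]: Ω_j, Λ_j *"are unions of MR_j-cubes in the lattice
T_{L^{−j}}"*), then `Λ_j^{∼−1} = Λ_j^0` (`innerN s 1 Λ` for both), while the unit tent `h_z` (*"h(t) = max{1 − |t|,
0}"* on `T_{L^{−j}}`) of a centre `z ∈ Λ_j^0` adjacent to `∂Λ_j^0` weighs fine points outside `Λ_j^0`, where nothing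
printed then forces `φ_j = 1`: the sentence is an extra condition.  If `∼` is [Balaban1987RG1] p. 257 [PDF 9]'s
operation over the `M`-cubes `π_j` (*"For a cube □ ∈ π_j and n = 1, 2, … we define □̃ⁿ as a cube of the size (1+2n)M
and with a center at the center of □. … The meaning of the symbol X̃ⁿ should be obvious."*; B14 names its deviations
explicitly, p. 256 *"where the operation ∼ is taken for M₁-cubes"*), then `Λ_j^{∼−1} ⊋ Λ_j^0` and the sentence FOLLOWS
from (2.24) once `2M + 1 ≤ MR_j` (a point weighed by `h_z` is within `1` of `z`, a point of an adjacent `M`-cube within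
`2M + 1`, and `within_innerN_subset` keeps the sup-`MR_j` neighbourhood of `z ∈ Λ_j^0` inside `Λ_j`), i.e. `R_j ≥ 3`,
given for `g_j` small by (2.5) p. 255 [PDF 13] *"R_j is the smallest number of the form L^r such, that R_j ≥
(log g_j⁻²)^r."*  The sibling module `B14Seam245` (v4/v4.1 §E) bounds the seam term of (2.45) WITHOUT that sentence
under either reading, from `supp(φ_j − φ_Ω) ⊆ seam` and `|φ_j − φ_Ω| ≤ 1` alone; the two membership facts it consumes
in this model are `mem_seam_of_within` (a unit tent centred outside `Λ_j^0` lives in `seam s 1 ν Λ_j`) and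
`mem_innerN_of_not_mem_seam` (off the seam one is in `Λ_j^0 ⊆ Λ_j^{∼−1}`, where `φ_j = 1` IS printed).  For
G-adv6-20's alternative repair (a)
(*demand* `φ_j = 1` on the unit neighbourhood of `Λ_j^0`, "room MR_j − 1 ≥ 1 units to ∂Λ_j") the room is
`within_innerN_subset` / `nbhd_of_nbhd_innerN_subset`: the sup-`s` neighbourhood of `Λ^{∼−1}` (side `s`) lies in `Λ`.
Cell GAPS.md G-adv6-21 (iii) (first proof of Theorem 2; p. 279 [PDF 37]: *"Let us assume that z ∈ Λ_j^0∩(Ω_n∖Ω_{n+1}),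
and let us take the cube □ ∈ π_n such that z ∈ □. … Consider the two cases (I.3.5): X ⊂ □̃², X∩(□̃²)^c ≠ ∅ (the
∼-operation is in the L^{−n}-scale)"*; p. 281 [PDF 39]: *"The identities (3.56) hold for the localization domains X
satisfying the condition X ⊂ □̃². We sum up the identities over all such domains, and we extend the sum on the
right-hand side to all domains X ∈ 𝐃_j for the space L^{−j}Z^d, X containing the point z"*): the identification of
torus terms with whole-lattice terms needs `□̃² ⊆ Λ_j`; for `n > j` and `z ∈ Ω_n` one has `□̃² ⊆ Λ_{n−1}` (`⊆ Λ_j`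
by (2.1)), because (3.5) keeps `Ω_n` eight `LMR_n`-layers (cubes of the (n−1)-st step) away from `Z_{n−1} =
Λ_{n−1}^c`, while `□̃²` (□ ∈ π_n of side `M` in n-units = `LM` in (n−1)-units, [I] p. 257) stays within sup-distance
`3LM` of `z`: `box2_subset_lambda_prev` (generic form `enl_single_subset_of_subset_compl_enl`).  For `n = j` adv6 needs
nothing ((3.67) is then `O(1)`, absorbed in `E₁`); not typed.  Revision v3 (unit `b2b-balaban-pv02` gen 4, journal
claim G-adv6-20-KERNEL): this section only; no existing declaration changed.  Revision v3.1 (journal claim DOCFIX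
G-pv13g3-2): the reading clauses of this header and of `mem_innerN_of_not_mem_seam`'s docstring; no declaration touched.
-/

/-- [folklore] -/
theorem Within.symm {r : ℤ} {x y : Pt d} (h : Within r x y) : Within r y x :=
  fun i => by rw [abs_sub_comm]; exact h i

/-- Cube indices (side `t`) at most `a` apart in every direction ⇒ sup-distance at most `(a+1)·t − 1`
(e.g. `□̃ᵃ` around the cube of `z` stays within `(a+1)t − 1` of `z`). [folklore] -/
theorem within_of_idxNear (t a : ℕ) (ht : 0 < t) {x z : Pt d} (h : IdxNear t a x z) :
    Within (((a : ℤ) + 1) * t - 1) x z := by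
  intro i
  have ht' : (0 : ℤ) < t := by exact_mod_cast ht
  have hx1 := cubeIdx_le t ht x i
  have hx2 := lt_cubeIdx t ht x i
  have hz1 := cubeIdx_le t ht z i
  have hz2 := lt_cubeIdx t ht z i
  obtain ⟨hlo, hhi⟩ := abs_le.mp (h i)
  have hup : (t : ℤ) * (cubeIdx t x i - cubeIdx t z i) ≤ (t : ℤ) * a :=
    mul_le_mul_of_nonneg_left hhi ht'.le
  have hdn : (t : ℤ) * -(a : ℤ) ≤ (t : ℤ) * (cubeIdx t x i - cubeIdx t z i) :=
    mul_le_mul_of_nonneg_left hlo ht'.le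
  rw [abs_le]
  constructor <;> linarith

/-- Conversely: sup-distance at most `n·s` ⇒ cube indices (side `s`) at most `n` apart. [folklore] -/
theorem idxNear_of_within (s n : ℕ) (hs : 0 < s) {x z : Pt d} (h : Within ((n : ℤ) * s) x z) :
    IdxNear s n x z := by
  intro i
  have hs' : (0 : ℤ) < s := by exact_mod_cast hs
  have hx1 := cubeIdx_le s hs x i
  have hx2 := lt_cubeIdx s hs x i
  have hz1 := cubeIdx_le s hs z i
  have hz2 := lt_cubeIdx s hs z i
  obtain ⟨hlo, hhi⟩ := abs_le.mp (h i)
  rw [abs_le]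
  constructor
  · by_contra hc
    push Not at hc
    have hc' : cubeIdx s x i - cubeIdx s z i + 1 ≤ -(n : ℤ) := by omega
    have hm : (s : ℤ) * (cubeIdx s x i - cubeIdx s z i + 1) ≤ (s : ℤ) * -(n : ℤ) :=
      mul_le_mul_of_nonneg_left hc' hs'.le
    linarith
  · by_contra hc
    push Not at hc
    have hc' : (n : ℤ) + 1 ≤ cubeIdx s x i - cubeIdx s z i := by omega
    have hm : (s : ℤ) * ((n : ℤ) + 1) ≤ (s : ℤ) * (cubeIdx s x i - cubeIdx s z i) :=
      mul_le_mul_of_nonneg_left hc' hs'.le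
    linarith

/-- A point within `w` of a point outside `Λ^{∼-n}` lies in `seam s n w Λ` — the definition, recorded for the
consumer `B14Seam245` §E: the unit tent `h_z` ((3.65) p. 283, sup-radius `ν`) of a centre `z ∉ Λ_j^0` is supported in
the seam. [folklore] -/
theorem mem_seam_of_within (s n : ℕ) (w : ℤ) {Λ : Set (Pt d)} {z y : Pt d} (hz : z ∉ innerN s n Λ)
    (hyz : Within w y z) : y ∈ seam s n w Λ :=
  ⟨z, hz, hyz⟩

/-- Off the seam (`w ≥ 0`) one is inside `innerN s n Λ` — for `n = 1`, `s = MR_j`, `Λ = Λ_j`: inside `Λ_j^0 ⊆ Λ_j^{∼−1}`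
(equality under the `MR_j`-cube reading of `∼` in (2.24), proper inclusion under the `M`-cube reading; §E header), where
p. 259 prints *"φ_j = 1 on Λ_j^{∼−1}"*. [folklore] -/
theorem mem_innerN_of_not_mem_seam (s n : ℕ) {w : ℤ} (hw : 0 ≤ w) {Λ : Set (Pt d)} {y : Pt d}
    (hy : y ∉ seam s n w Λ) : y ∈ innerN s n Λ := by
  by_contra h
  exact hy ⟨y, h, Within.refl hw y⟩

/-- **Room for G-adv6-20's repair (a).**  The sup-`n·s` neighbourhood of `Λ^{∼-n}` (side `s`) lies in `Λ`; for
`n = 1`, `s = MR_j·ν ≥ ν`: every point within one unit (indeed within `MR_j` units) of `Λ_j^0` lies in `Λ_j`.  No cube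
structure of `Λ` is needed (`innerN` quantifies over index-neighbours). [folklore] -/
theorem within_innerN_subset (s n : ℕ) (hs : 0 < s) {Λ : Set (Pt d)} {x z : Pt d} (hz : z ∈ innerN s n Λ)
    (hxz : Within ((n : ℤ) * s) x z) : x ∈ Λ :=
  hz.2 x (idxNear_of_within s n hs hxz).symm

/-- Hence the `(s − w)`-neighbourhood of the `w`-neighbourhood of `Λ^{∼-1}` lies in `Λ` (adv6's "room MR_j − 1 ≥ 1
units to ∂Λ_j" for the unit neighbourhood, `w = ν`, `s = MR_jν`). [folklore] -/
theorem nbhd_of_nbhd_innerN_subset (s : ℕ) (hs : 0 < s) (w : ℤ) {Λ : Set (Pt d)} {x y z : Pt d}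
    (hz : z ∈ innerN s 1 Λ) (hyz : Within w y z) (hxy : Within ((s : ℤ) - w) x y) : x ∈ Λ :=
  within_innerN_subset s 1 hs hz ((hxy.triangle hyz).mono (by push_cast; linarith))

/-- **Generic `□̃ᵃ ⊆ Λ`.**  If `Ω` misses `(Λ^c)^{∼m}` (side `s'`) and `(a+1)·t − 1 ≤ m·s'`, then for every `z ∈ Ω`
the `a`-fold enlargement (side `t`) of `{z}` — i.e. of the side-`t` cube of `z` (`enl_enl`) — lies in `Λ`. [folklore] -/
theorem enl_single_subset_of_subset_compl_enl (t a s' m : ℕ) (ht : 0 < t) (hs' : 0 < s') {Λ Ω : Set (Pt d)}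
    (hΩ : Ω ⊆ (enl s' m Λᶜ)ᶜ) {z : Pt d} (hz : z ∈ Ω) (hnum : ((a : ℤ) + 1) * t - 1 ≤ (m : ℤ) * s') :
    enl t a {z} ⊆ Λ := by
  rintro x ⟨y, hy, hxy⟩
  rw [Set.mem_singleton_iff] at hy
  subst hy
  by_contra hxΛ
  exact not_within_of_subset_compl_enl s' m hs' hΩ hz hxΛ ((within_of_idxNear t a ht hxy).symm.mono hnum)

/-- **`□̃² ⊆ Λ_{n−1}` (cell GAPS.md G-adv6-21 (iii)).**  Step `n−1 → n` of (3.5) in η-lattice points (`ν` points per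
(n−1)-unit): `Λ = Λ_{n−1}`, `Z_{n−1} = Λ^c`, the `LMR_n`-cubes of (3.5) have side `s' = LMR_nν`, and `Ω = Ω_n =
(Q′^{∼2} ∪ (B^c)^{∼3})^c`, `B = (P′^∼)^c ∩ (Z′^{∼5})^c`; the cubes `□ ∈ π_n` ([I] p. 257: *"closed cubes of a size M"*
in n-units) have side `t = LMν`.  Then for every `z ∈ Ω_n` the cube `□ ∋ z` satisfies `□̃² ⊆ Λ_{n−1}`: the margin is
`8·LMR_nν ≥ 8LMν > 3LMν` (so the closed-cube reading of `□̃²`, one fine layer more, is covered as well).  Uses only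
(3.5) — not (2.9), not the cube structure of `Λ_{n−1}`, not p. 256's "2MR_j" sentence. [cite: Balaban1988Convergent,
(3.5) p.265, p.279 (□ ∈ π_n, z ∈ □; cases X ⊂ □̃²), p.281 ("The identities (3.56) hold for … X ⊂ □̃²");
Balaban1987RG1, p.257 (π_j, □̃ⁿ)] -/
theorem box2_subset_lambda_prev (L M Rn ν : ℕ) (hL : 1 ≤ L) (hM : 1 ≤ M) (hR : 1 ≤ Rn) (hν : 1 ≤ ν)
    {Λ Pt' Q2 B Ω : Set (Pt d)}
    (hB : B = Pt'ᶜ ∩ (enl (L * M * Rn * ν) 5 (enl (L * M * Rn * ν) 0 Λᶜ))ᶜ)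
    (hΩ : Ω = (Q2 ∪ enl (L * M * Rn * ν) 3 Bᶜ)ᶜ) {z : Pt d} (hz : z ∈ Ω) :
    enl (L * M * ν) 2 (enl (L * M * ν) 0 {z}) ⊆ Λ := by
  have ht : 0 < L * M * ν := Nat.mul_pos (Nat.mul_pos hL hM) hν
  have hs' : 0 < L * M * Rn * ν := Nat.mul_pos (Nat.mul_pos (Nat.mul_pos hL hM) hR) hν
  have h8 := omega35_subset_compl_enl (L * M * Rn * ν) hs' Λᶜ Pt' Q2 B Ω hB hΩ
  rw [enl_enl (L * M * ν) 0 2 ht]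
  refine enl_single_subset_of_subset_compl_enl (L * M * ν) 2 (L * M * Rn * ν) 8 ht hs' h8 hz ?_
  have hR' : (1 : ℤ) ≤ Rn := by exact_mod_cast hR
  have h0 : (0 : ℤ) ≤ (L : ℤ) * M * ν := by positivity
  have h1 : (L : ℤ) * M * ν ≤ (L : ℤ) * M * Rn * ν := by
    calc (L : ℤ) * M * ν = (L : ℤ) * M * ν * 1 := by ring
      _ ≤ (L : ℤ) * M * ν * Rn := mul_le_mul_of_nonneg_left hR' h0
      _ = (L : ℤ) * M * Rn * ν := by ring
  push_cast
  nlinarith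

/-! ## F. (v4) Two-partition corner-cube containment `□^{∼n} ⊆ □′^{∼m} ⟺ n·s ≤ m·s′` (cell GAPS.md C-adv5-92 (3), C-adv5-93)

Cell GAPS.md C-adv5-92 (3) (adversarial reader adv5, gen 73) and C-adv5-93 (gen 74), whose NEXT item reads *"type
the (b)/(c)-invariant containment equivalences (□^{∼4} ⊂ □′^∼ ⟺ 4R_k ≤ LR_{k+1}; □^{∼4} ⊂ □′^{∼2} ⟺ 2R_k ≤ LR_{k+1})
as a `B14DomainGeom`-style lemma if the B14 sub-cell wants it"*.
THE PRINTED SITUATION.  p. 257 [PDF 15]: *"We consider the partition of the lattice T_η into LM₂R_k-cubes, compatible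
with the other partitions, and for each cube □ of this partition we define the function U_{k,□}(V_k) by U_{k,□}(V_k)
= U(𝐁_k(□^{∼4}), M˙(Q_k^{s*}V_k)) , (2.16)"*, and (2.17) takes *"sup_{p⊂□^∼}"*; p. 265 [PDF 23] (step k+1): *"The
cubes are from the partition of the lattice T_η into cubes of the size L²M₂R_{k+1}, or the partition of the lattice
T_{L⁻¹η} into cubes of the size LM₂R_{k+1}. The partition is compatible with all the other partitions."*; (3.3) takes
*"sup_{b∈(□′^{∼2})^{(k)*}} |V_k(b)(V_{□′}^{(k)}(b))⁻¹ − 1| < 2δ_k"* and *"The configuration V_{□′}^{(k)} is defined on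
(□′^∼)^{(k)} by V_{□′}^{(k)} = M^k(U_{k+1,□′}) , (3.4)"*; pp. 265–266 [PDF 23–24]: *"Take χ_k(□) for a cube
□⊂Ω^∼_{k+1}. This cube determines a cube □′ of the next partition, such that □⊂□′⊂Ω^∼_{k+1}. For the function U_{k,□}
we have U_{k,□} = U(𝐁_k(□^{∼4}), [M˙(Q_k^{s*}V_k)(M˙(U_{k+1,□′}))⁻¹]M˙(U_{k+1,□′})) … (3.6)"*.  Cell row C-adv5-92 (3)
reads the passage from (3.6) to (3.7) as using, on `□^{∼4}`, the control (3.3) printed on `□′^{∼2}` (and the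
configuration (3.4) printed on `□′^∼`), i.e. as needing `□^{∼4} ⊆ □′^{∼2}` (resp. `⊆ □′^∼`) for the corner cubes
`□ ⊂ □′`.  WHICH cube family the operation `∼` uses on `□` at (2.16)–(2.17) and on `□′` at (3.3)–(3.4) is NOT printed
there (C-adv5-93 (1)–(2): p. 246 [PDF 4] *"(the operation ^∼ is determined by the LMR₁-cubes)"* is attached to the
step-1 construction before (1.2), and p. 256's *"where the operation ∼ is taken for M₁-cubes"* to one determining-set
sentence); the cell's two supported readings are (c) layers of the FIRST partition of the step (`MR_k`-cube layers on
`□`, `LMR_{k+1}`-cube layers on `□′` — the (1.2)/(1.4) template) and (b) layers of each cube's OWN partition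
(`LM₂R_k`-cubes for `□`, `L²M₂R_{k+1}`-cubes for `□′`).
WHAT IS TYPED (all [folklore]; the two sides `s`, `s'` are FREE parameters, so no reading and no sentence of B14 is
asserted).  `pcube s a` is the cube of index `a` of the side-`s` partition.  For a nested pair `pcube s a ⊆ pcube s' a'`
(p. 266 *"□⊂□′"*) one has `enl s n (pcube s a) ⊆ enl s' m (pcube s' a')` as soon as `n·s ≤ m·s'`
(`enl_pcube_subset_enl_pcube`: the `n` layers of side `s` around `□` stay inside the `m` layers of side `s'` around
`□′`, corners included), and this is SHARP: the corner pair `a = a' = 0` violates the inclusion whenever `m·s' < n·s`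
(`not_enl_pcube_zero_subset`), whence the biconditional over all nested pairs (`enl_pcube_nested_iff`; `d ≥ 1`,
`0 < s ≤ s'`).  With a common unit `u` (`u = M·ν` for reading (c), `u = LM₂·ν` for reading (b); `ν` = lattice points
per length unit) and sides `s = u·R_k`, `s' = u·L·R_{k+1}` the condition is the same for every `u`, i.e.
READING-INVARIANT (`corner_containment_iff`): `(n, m) = (4, 2)` ⟺ `2R_k ≤ LR_{k+1}` (`box4_subset_boxprime2_iff`) and
`(n, m) = (4, 1)` ⟺ `4R_k ≤ LR_{k+1}` (`box4_subset_boxprime1_iff`) — C-adv5-93 (3)'s two equivalences, kernel-checked.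
For radii of the printed form (2.5) p. 255 (*"R_j is the smallest number of the form L^r such, that R_j ≥
(log g_j⁻²)^r"*; write `R_k = L^a`, `R_{k+1} = L^b`): `2L^a ≤ L·L^b ⟺ a ≤ b` (`two_mul_pow_le_iff` — the `(4, 2)`
containment is exactly MONOTONICITY `R_k ≤ R_{k+1}`), and `4L^a ≤ L·L^b ⟺ a ≤ b` when `L ≥ 4`, `⟺ a + 1 ≤ b` when
`L ∈ {2, 3}` (`four_mul_pow_le_iff_of_four_le`, `four_mul_pow_le_iff_of_lt_four`).  (2.9) p. 256 alone (quoted in the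
module docstring; members `R_n ≦ LR_m` and `R_m ≦ … ≦ (L+1)(n−m)^{β₀}R_n` at `n = k+1`, `m = k`) does NOT give it:
`L = 2, R_k = 2 = L¹, R_{k+1} = 1 = L⁰` satisfies `R_{k+1} ≤ LR_k`, `R_k ≤ LR_{k+1}` and `R_k ≤ (L+1)R_{k+1}` and violates
`2R_k ≤ LR_{k+1}` (`ineq29_allows_failure`) — C-adv5-93 (3)'s *"(2.9) … allows R_{k+1} = R_k/L"*; monotone radii
(`layers42_of_monotone`) or, for `(4, 1)`, `L ≥ 4` with monotone radii / a lag `LR_k ≤ R_{k+1}`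
(`layers41_of_monotone`, `layers41_of_lag`) restore it.  Nothing here adjudicates which repair, if any, the text
intends (the cell classes the item *"convention gap / unprinted step — NOT suspected-false"*; S-rows are r2's call).
Renders p004, p015, p023, p024 of [Balaban1988Convergent] READ AS IMAGES for this revision (unit `b2b-balaban-pv02`
gen 24, journal claim PV02-G24-B14DOMAINGEOM-V4); §F only; no existing declaration changed.
-/

/-- The cube of index `a` of the side-`s` partition, as a set of lattice points: `{y | cubeIdx s y = a}` = `{y | ∀ i,
s·a i ≤ y i < s·a i + s}` (`cubeIdx_eq_of_mem`).  B14's partition cubes `□` (p. 257: *"each cube □ of this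
partition"*) and `□′` (p. 265: *"a cube □′ of the next partition"*) are such sets for two sides `s ≤ s'`; the sides
are parameters (the module docstring, MODELLING). [folklore] -/
def pcube (s : ℕ) (a : Pt d) : Set (Pt d) := {y | cubeIdx s y = a}

/-- The lower corner `s·a` lies in the cube of index `a`. [folklore] -/
theorem corner_mem_pcube (s : ℕ) (hs : 0 < s) (a : Pt d) : (fun i => (s : ℤ) * a i) ∈ pcube s a :=
  cubeIdx_corner s hs a

/-- The upper corner `s·a + (s − 1)` lies in the cube of index `a`. [folklore] -/
theorem top_mem_pcube (s : ℕ) (hs : 0 < s) (a : Pt d) :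
    (fun i => (s : ℤ) * a i + ((s : ℤ) - 1)) ∈ pcube s a := by
  have hs' : (1 : ℤ) ≤ s := by exact_mod_cast hs
  exact cubeIdx_eq_of_mem s hs _ a fun i => ⟨by linarith, by linarith⟩

/-- Membership in `□^{∼n}` for a partition cube `□ = pcube s a`, coordinatewise: the cube index of `x` is within `n`
of `a` in every direction. [folklore] -/
theorem mem_enl_pcube_iff (s n : ℕ) (hs : 0 < s) (a x : Pt d) :
    x ∈ enl s n (pcube s a) ↔ ∀ i, |cubeIdx s x i - a i| ≤ n := by
  constructor
  · rintro ⟨y, hy, hn⟩ i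
    have hy' : cubeIdx s y = a := hy
    have h := hn i
    rw [hy'] at h
    exact h
  · intro h
    refine ⟨fun i => (s : ℤ) * a i, corner_mem_pcube s hs a, fun i => ?_⟩
    rw [cubeIdx_corner s hs a]
    exact h i

/-- **Corner-cube containment, sufficiency.**  If the side-`s` cube `□ = pcube s a` lies in the side-`s'` cube
`□′ = pcube s' a'` and `n·s ≤ m·s'`, then `□^{∼n} ⊆ □′^{∼m}` (`n` layers of side-`s` cubes around `□` versus `m`
layers of side-`s'` cubes around `□′`, sup-metric, corners included).  No divisibility / compatibility of the two
partitions is used — only `□ ⊆ □′`. [folklore] -/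
theorem enl_pcube_subset_enl_pcube (s s' n m : ℕ) (hs : 0 < s) (hs' : 0 < s') {a a' : Pt d}
    (hsub : pcube s a ⊆ pcube s' a') (hnm : n * s ≤ m * s') :
    enl s n (pcube s a) ⊆ enl s' m (pcube s' a') := by
  intro x hx
  rw [mem_enl_pcube_iff s n hs] at hx
  rw [mem_enl_pcube_iff s' m hs']
  have hc : cubeIdx s' (fun i => (s : ℤ) * a i) = a' := hsub (corner_mem_pcube s hs a)
  have ht : cubeIdx s' (fun i => (s : ℤ) * a i + ((s : ℤ) - 1)) = a' := hsub (top_mem_pcube s hs a)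
  have hspos : (0 : ℤ) < s := by exact_mod_cast hs
  have hs'pos : (0 : ℤ) < s' := by exact_mod_cast hs'
  have hnm' : (n : ℤ) * s ≤ (m : ℤ) * s' := by exact_mod_cast hnm
  intro i
  -- the corner and the top of `□` lie in `□′`: `s'·a' i ≤ s·a i` and `s·a i + s − 1 < s'·a' i + s'`
  have h1 : (s' : ℤ) * a' i ≤ (s : ℤ) * a i := by
    have h := cubeIdx_le s' hs' (fun i => (s : ℤ) * a i) i
    rw [hc] at h
    exact h
  have h2 : (s : ℤ) * a i + ((s : ℤ) - 1) < (s' : ℤ) * a' i + s' := by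
    have h := lt_cubeIdx s' hs' (fun i => (s : ℤ) * a i + ((s : ℤ) - 1)) i
    rw [ht] at h
    exact h
  have hx1 := cubeIdx_le s hs x i
  have hx2 := lt_cubeIdx s hs x i
  have hy1 := cubeIdx_le s' hs' x i
  have hy2 := lt_cubeIdx s' hs' x i
  obtain ⟨hlo, hhi⟩ := abs_le.mp (hx i)
  -- `x i` in terms of the side-`s` index, then of `a i`
  have hxlo : (s' : ℤ) * (a' i - m) ≤ x i := by
    have hm : (s : ℤ) * (a i - n) ≤ (s : ℤ) * cubeIdx s x i := mul_le_mul_of_nonneg_left (by linarith) hspos.le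
    have e1 : (s : ℤ) * (a i - n) = (s : ℤ) * a i - (n : ℤ) * s := by ring
    have e2 : (s' : ℤ) * (a' i - m) = (s' : ℤ) * a' i - (m : ℤ) * s' := by ring
    linarith
  have hxhi : x i < (s' : ℤ) * (a' i + m + 1) := by
    have hm : (s : ℤ) * cubeIdx s x i ≤ (s : ℤ) * (a i + n) := mul_le_mul_of_nonneg_left (by linarith) hspos.le
    have e1 : (s : ℤ) * (a i + n) = (s : ℤ) * a i + (n : ℤ) * s := by ring
    have e2 : (s' : ℤ) * (a' i + m + 1) = (s' : ℤ) * a' i + (m : ℤ) * s' + s' := by ring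
    linarith
  rw [abs_le]
  constructor
  · -- `s'·(a' i − m) ≤ x i < s'·(cubeIdx s' x i + 1)` ⇒ `a' i − m ≤ cubeIdx s' x i`
    have hlt : (s' : ℤ) * (a' i - m) < (s' : ℤ) * (cubeIdx s' x i + 1) := by linarith
    have := lt_of_mul_lt_mul_left hlt hs'pos.le
    linarith
  · -- `s'·cubeIdx s' x i ≤ x i < s'·(a' i + m + 1)` ⇒ `cubeIdx s' x i ≤ a' i + m`
    have hlt : (s' : ℤ) * cubeIdx s' x i < (s' : ℤ) * (a' i + m + 1) := by linarith
    have := lt_of_mul_lt_mul_left hlt hs'pos.le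
    linarith

/-- The side-`s` cube at the origin lies in the side-`s'` cube at the origin when `s ≤ s'` (a nested corner pair,
p. 266 *"□⊂□′"*). [folklore] -/
theorem pcube_zero_subset (s s' : ℕ) (hs : 0 < s) (hss' : s ≤ s') : pcube s (0 : Pt d) ⊆ pcube s' 0 := by
  intro y hy
  have hy' : cubeIdx s y = 0 := hy
  have hss'' : (s : ℤ) ≤ s' := by exact_mod_cast hss'
  refine cubeIdx_eq_of_mem s' (lt_of_lt_of_le hs hss') y 0 fun i => ?_
  have h1 := cubeIdx_le s hs y i
  have h2 := lt_cubeIdx s hs y i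
  have h0 : cubeIdx s y i = 0 := by rw [hy']; rfl
  rw [h0] at h1 h2
  simp only [Pi.zero_apply, mul_zero, zero_add] at h1 h2 ⊢
  exact ⟨h1, lt_of_lt_of_le h2 hss''⟩

/-- **Corner-cube containment, sharpness.**  If `m·s' < n·s` then already the corner pair at the origin violates
`□^{∼n} ⊆ □′^{∼m}`: the point `−n·s` (all coordinates) lies in `□^{∼n}` but its side-`s'` cube index is below `−m`
(`d ≥ 1`). [folklore] -/
theorem not_enl_pcube_zero_subset (hd : 0 < d) (s s' n m : ℕ) (hs : 0 < s) (hs' : 0 < s') (hlt : m * s' < n * s) :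
    ¬ enl s n (pcube s (0 : Pt d)) ⊆ enl s' m (pcube s' 0) := by
  intro hsub
  have hsne : (s : ℤ) ≠ 0 := by exact_mod_cast hs.ne'
  have hlt' : (m : ℤ) * s' < (n : ℤ) * s := by exact_mod_cast hlt
  set x : Pt d := fun _ => (-(n : ℤ)) * s with hxdef
  have hidx : ∀ i, cubeIdx s x i = -(n : ℤ) := fun i => by
    simp only [cubeIdx, hxdef]
    exact Int.mul_ediv_cancel _ hsne
  have hx : x ∈ enl s n (pcube s (0 : Pt d)) := by
    rw [mem_enl_pcube_iff s n hs]
    intro i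
    rw [hidx i]
    simp
  have hx' := hsub hx
  rw [mem_enl_pcube_iff s' m hs'] at hx'
  let i : Fin d := ⟨0, hd⟩
  have hm := (abs_le.mp (hx' i)).1
  simp only [Pi.zero_apply, sub_zero] at hm
  have h1 := cubeIdx_le s' hs' x i
  have hxi : x i = (-(n : ℤ)) * s := rfl
  have hs'0 : (0 : ℤ) ≤ s' := by exact_mod_cast hs'.le
  have h2 : (s' : ℤ) * (-(m : ℤ)) ≤ (s' : ℤ) * cubeIdx s' x i := mul_le_mul_of_nonneg_left hm hs'0
  rw [hxi] at h1
  linarith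

/-- **Corner-cube containment, the criterion** (`d ≥ 1`, `0 < s ≤ s'`): `□^{∼n} ⊆ □′^{∼m}` for EVERY nested pair of a
side-`s` cube `□` in a side-`s'` cube `□′` iff `n·s ≤ m·s'`. [folklore] -/
theorem enl_pcube_nested_iff (hd : 0 < d) (s s' n m : ℕ) (hs : 0 < s) (hss' : s ≤ s') :
    (∀ a a' : Pt d, pcube s a ⊆ pcube s' a' → enl s n (pcube s a) ⊆ enl s' m (pcube s' a')) ↔ n * s ≤ m * s' := by
  have hs' : 0 < s' := lt_of_lt_of_le hs hss'
  constructor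
  · intro h
    by_contra hlt
    push Not at hlt
    exact not_enl_pcube_zero_subset hd s s' n m hs hs' hlt (h 0 0 (pcube_zero_subset s s' hs hss'))
  · intro hnm a a' hsub
    exact enl_pcube_subset_enl_pcube s s' n m hs hs' hsub hnm

/-- Cancelling a common unit: `n·(u·A) ≤ m·(u·B)` iff `n·A ≤ m·B` (`u > 0`). [folklore] -/
theorem layers_unit_iff (u n m A B : ℕ) (hu : 0 < u) : n * (u * A) ≤ m * (u * B) ↔ n * A ≤ m * B := by
  have e1 : n * (u * A) = u * (n * A) := by ring
  have e2 : m * (u * B) = u * (m * B) := by ring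
  rw [e1, e2]
  exact ⟨fun h => Nat.le_of_mul_le_mul_left h hu, fun h => Nat.mul_le_mul_left u h⟩

/-- **Reading-invariance (cell GAPS.md C-adv5-93 (3)).**  With any common unit `u > 0` (`u = M·ν` for the
first-partition reading (c): `MR_k`- vs `LMR_{k+1}`-cube layers; `u = LM₂·ν` for the own-partition reading (b):
`LM₂R_k`- vs `L²M₂R_{k+1}`-cube layers) and sides `s = u·R_k ≤ s' = u·L·R_{k+1}`: `□^{∼n} ⊆ □′^{∼m}` for every nested
pair iff `n·R_k ≤ m·(L·R_{k+1})` — the unit cancels. [folklore] -/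
theorem corner_containment_iff (hd : 0 < d) (u L Rk Rk1 n m : ℕ) (hu : 0 < u) (hRk : 0 < Rk)
    (hfit : Rk ≤ L * Rk1) :
    (∀ a a' : Pt d, pcube (u * Rk) a ⊆ pcube (u * (L * Rk1)) a' →
        enl (u * Rk) n (pcube (u * Rk) a) ⊆ enl (u * (L * Rk1)) m (pcube (u * (L * Rk1)) a')) ↔
      n * Rk ≤ m * (L * Rk1) := by
  rw [enl_pcube_nested_iff hd (u * Rk) (u * (L * Rk1)) n m (Nat.mul_pos hu hRk) (Nat.mul_le_mul_left u hfit)]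
  exact layers_unit_iff u n m Rk (L * Rk1) hu

/-- **`□^{∼4} ⊆ □′^{∼2}` for every nested pair ⟺ `2R_k ≤ LR_{k+1}`** — the (3.3)-domain version of C-adv5-93 (3),
for either reading (unit `u`), given the printed nesting `□ ⊂ □′` (p. 266; `R_k ≤ LR_{k+1}`). [folklore] -/
theorem box4_subset_boxprime2_iff (hd : 0 < d) (u L Rk Rk1 : ℕ) (hu : 0 < u) (hRk : 0 < Rk)
    (hfit : Rk ≤ L * Rk1) :
    (∀ a a' : Pt d, pcube (u * Rk) a ⊆ pcube (u * (L * Rk1)) a' →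
        enl (u * Rk) 4 (pcube (u * Rk) a) ⊆ enl (u * (L * Rk1)) 2 (pcube (u * (L * Rk1)) a')) ↔
      2 * Rk ≤ L * Rk1 := by
  rw [corner_containment_iff hd u L Rk Rk1 4 2 hu hRk hfit]
  constructor <;> intro h <;> omega

/-- **`□^{∼4} ⊆ □′^∼` for every nested pair ⟺ `4R_k ≤ LR_{k+1}`** — the (3.4)-domain version of C-adv5-93 (3), for
either reading (unit `u`). [folklore] -/
theorem box4_subset_boxprime1_iff (hd : 0 < d) (u L Rk Rk1 : ℕ) (hu : 0 < u) (hRk : 0 < Rk)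
    (hfit : Rk ≤ L * Rk1) :
    (∀ a a' : Pt d, pcube (u * Rk) a ⊆ pcube (u * (L * Rk1)) a' →
        enl (u * Rk) 4 (pcube (u * Rk) a) ⊆ enl (u * (L * Rk1)) 1 (pcube (u * (L * Rk1)) a')) ↔
      4 * Rk ≤ L * Rk1 := by
  rw [corner_containment_iff hd u L Rk Rk1 4 1 hu hRk hfit]
  constructor <;> intro h <;> omega

/-- **(2.9) alone allows failure** (C-adv5-93 (3): *"(2.9) guarantees only R_k ≤ LR_{k+1}, which allows R_{k+1} =
R_k/L"*).  `L = 2`, `R_k = 2 = L¹`, `R_{k+1} = 1 = L⁰` satisfy the printed members of (2.9) at `n = k+1, m = k`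
(`R_{k+1} ≦ LR_k`, `R_k ≦ … ≦ (L+1)R_{k+1}`, even `R_k ≤ LR_{k+1}`), both radii are powers of `L` as in (2.5), and
`2R_k ≤ LR_{k+1}` FAILS — so the `(4, 2)` containment fails for the corner pair (`box4_subset_boxprime2_iff`). [folklore] -/
theorem ineq29_allows_failure : ∃ L Rk Rk1 : ℕ, 2 ≤ L ∧ Rk = L ^ 1 ∧ Rk1 = L ^ 0 ∧ Rk1 ≤ L * Rk ∧
    Rk ≤ L * Rk1 ∧ Rk ≤ (L + 1) * Rk1 ∧ ¬ 2 * Rk ≤ L * Rk1 :=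
  ⟨2, 2, 1, by decide⟩

/-- Monotone radii give the `(4, 2)` containment condition for every `L ≥ 2` (C-adv5-92 (3)'s first one-token
repair *"the convention R_{k+1} ≥ R_k"*). [folklore] -/
theorem layers42_of_monotone (L Rk Rk1 : ℕ) (hL : 2 ≤ L) (hmono : Rk ≤ Rk1) : 2 * Rk ≤ L * Rk1 := by
  calc 2 * Rk ≤ 2 * Rk1 := Nat.mul_le_mul_left 2 hmono
    _ ≤ L * Rk1 := Nat.mul_le_mul_right Rk1 hL

/-- Monotone radii give the `(4, 1)` condition when `L ≥ 4`. [folklore] -/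
theorem layers41_of_monotone (L Rk Rk1 : ℕ) (hL : 4 ≤ L) (hmono : Rk ≤ Rk1) : 4 * Rk ≤ L * Rk1 := by
  calc 4 * Rk ≤ 4 * Rk1 := Nat.mul_le_mul_left 4 hmono
    _ ≤ L * Rk1 := Nat.mul_le_mul_right Rk1 hL

/-- A lag of one power (`LR_k ≤ R_{k+1}`) gives the `(4, 1)` condition for every `L ≥ 2`. [folklore] -/
theorem layers41_of_lag (L Rk Rk1 : ℕ) (hL : 2 ≤ L) (hlag : L * Rk ≤ Rk1) : 4 * Rk ≤ L * Rk1 := by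
  have h4 : 4 ≤ L * L := Nat.mul_le_mul hL hL
  calc 4 * Rk ≤ L * L * Rk := Nat.mul_le_mul_right Rk h4
    _ = L * (L * Rk) := by ring
    _ ≤ L * Rk1 := Nat.mul_le_mul_left L hlag

/-- **Radii of the form (2.5) (`R_k = L^a`, `R_{k+1} = L^b`, `L ≥ 2`): the `(4, 2)` condition `2L^a ≤ L·L^b` is
exactly `a ≤ b`, i.e. MONOTONICITY `R_k ≤ R_{k+1}`** (C-adv5-93 (3): *"□^{∼4} ⊂ □′^{∼2} … ⟺ 2R_k ≤ LR_{k+1} ⟺ R_{k+1}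
≥ R_k (both powers of L by (2.5))"*). [folklore] -/
theorem two_mul_pow_le_iff (L a b : ℕ) (hL : 2 ≤ L) : 2 * L ^ a ≤ L * L ^ b ↔ a ≤ b := by
  have hL0 : 0 < L := by omega
  constructor
  · intro h
    by_contra hba
    push Not at hba
    have h1 : L * L ^ b ≤ L ^ a := by
      rw [← pow_succ']
      exact Nat.pow_le_pow_right hL0 (by omega)
    have h2 : 0 < L ^ a := Nat.pow_pos hL0
    omega
  · intro hab
    calc 2 * L ^ a ≤ L * L ^ a := Nat.mul_le_mul_right (L ^ a) hL
      _ ≤ L * L ^ b := Nat.mul_le_mul_left L (Nat.pow_le_pow_right hL0 hab)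

/-- (2.5)-radii, `L ≥ 4`: the `(4, 1)` condition `4L^a ≤ L·L^b` is again `a ≤ b` (C-adv5-93 (3): *"R_{k+1} ≥ R_k for
L ≥ 4"*). [folklore] -/
theorem four_mul_pow_le_iff_of_four_le (L a b : ℕ) (hL : 4 ≤ L) : 4 * L ^ a ≤ L * L ^ b ↔ a ≤ b := by
  have hL0 : 0 < L := by omega
  constructor
  · intro h
    by_contra hba
    push Not at hba
    have h1 : L * L ^ b ≤ L ^ a := by
      rw [← pow_succ']
      exact Nat.pow_le_pow_right hL0 (by omega)
    have h2 : 0 < L ^ a := Nat.pow_pos hL0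
    omega
  · intro hab
    calc 4 * L ^ a ≤ L * L ^ a := Nat.mul_le_mul_right (L ^ a) hL
      _ ≤ L * L ^ b := Nat.mul_le_mul_left L (Nat.pow_le_pow_right hL0 hab)

/-- (2.5)-radii, `L ∈ {2, 3}`: the `(4, 1)` condition `4L^a ≤ L·L^b` is `a + 1 ≤ b`, i.e. `R_{k+1} ≥ LR_k` (C-adv5-93
(3): *"and R_{k+1} ≥ LR_k for L ∈ {2,3}"*). [folklore] -/
theorem four_mul_pow_le_iff_of_lt_four (L a b : ℕ) (hL : 2 ≤ L) (hL4 : L < 4) :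
    4 * L ^ a ≤ L * L ^ b ↔ a + 1 ≤ b := by
  have hL0 : 0 < L := by omega
  have hp : 0 < L ^ a := Nat.pow_pos hL0
  constructor
  · intro h
    by_contra hba
    push Not at hba
    have h1 : L * L ^ b ≤ L * L ^ a := Nat.mul_le_mul_left L (Nat.pow_le_pow_right hL0 (by omega))
    have h2 : L * L ^ a ≤ 3 * L ^ a := Nat.mul_le_mul_right (L ^ a) (by omega)
    omega
  · intro hab
    have h1 : L ^ (a + 1) ≤ L ^ b := Nat.pow_le_pow_right hL0 hab
    rw [pow_succ'] at h1
    have h4 : 4 ≤ L * L := Nat.mul_le_mul hL hL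
    calc 4 * L ^ a ≤ L * L * L ^ a := Nat.mul_le_mul_right (L ^ a) h4
      _ = L * (L * L ^ a) := by ring
      _ ≤ L * L ^ b := Nat.mul_le_mul_left L h1

end Literature.MathematicalPhysics.QuantumFieldTheory.Balaban1983to89.B14DomainGeom
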